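import Mathlib
import HarnessLib.Audit
import Summits.PneNP.PneNP.Theorems.PstarNorUnitBridge
import Summits.PneNP.PneNP.Theorems.PstarChordBridgeBasis

/-!
# The NOR case in a READ DIRECTION `m` is a CONS-T unit (glue `PstarChordBridgeBasis.regime_cases` ⟶ `nor_unit_na`; ROUND-24, memo §9 R5–R8)

FRONTIER range-avoidance ladder, rung F-N3, ROUND 24 (cell `pnp-ideate`, planner memo `r24/CORE-BOUND-NOTES.md` §9 R5–R8, §10 O5;
restricted-model proof complexity — nothing here bears on `P` versus `NP`).

`PstarNorUnitBridge.nor_unit_of_bridge` reads the NOR case with respect to the SECOND constraint `free₂ + b₂` of the bridge's chord system.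
After the direction collapse (`PstarChordBridgeCollapse`, `PstarChordSystemMap`) the relevant constraint is the basis-changed one,
`q_m = m₂(free₁ + b₁) + m₁(free₂ + b₂)` (`PstarChordBridgeBasis.qDir`, polar form `polarDir = m₂•freePolar₁ + m₁•freePolar₂`), and
`PstarChordBridgeBasis.regime_cases` / `forced_chord_cases_dir` (pnp-ideate-prover-2) return the (EQ)/(EXC)/(NOR) trichotomy for it.  This file
is the same glue for `q_m`:

* `exists_realiser_of_polarDir` — `polarDir(e_v, e_w) = 1` ⟹ some output of `T₁ ∪ freeMon N G₁ ∪ T₂ ∪ freeMon N G₂` has AND pair `{v, w}`;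
* `nor_unit_of_dir` — **in the NOR case of `forced_chord_cases_dir` the fundamental set `D e` is a CONS-T pair**: `D e = {j₁, j₂}` with disjoint
  AND pairs, literal variables `{v : polarDir(e_v, b) ≠ 0 ∨ polarDir(e_v, a) ≠ 0}` EXACTLY `{σ, τ}` (`σ ∈ andPair j₁`, `τ ∈ andPair j₂`), and a
  realiser of `{σ, τ}` (the NOR gadget) among the joins / private-free pendants;
* `lit_iff_of_dir` — the literal pair is chord-independent (`v` literal ⟺ `q_m` not invariant under `x ↦ x + e_v`).

The all-chords assembly for `q_m` is `PstarNorUnitDirAssembly.card_le_five_of_all_nor_dir`.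
-/

set_option linter.dupNamespace false -- `Summit.PneNP.PneNP.…`: summit = sub-problem name (D-0017 single-conjunct layout)

open Finset Module Literature.Computability.Complexity
open Summit.PneNP.PneNP.Theorems.PstarSALevel (varSet bdry BoundaryExpanding SimpleOverlap)
open Summit.PneNP.PneNP.Theorems.PstarGapLinearised (andPair andPair_subset_varSet)
open Summit.PneNP.PneNP.Theorems.PstarChordEndgameTools (mem_andPair_iff)
open Summit.PneNP.PneNP.Theorems.PstarCentreFree (vars_mem_varSet)
open Summit.PneNP.PneNP.Theorems.PstarNorCoreTools (eq_of_mem_bdry vars_zero_ne_one)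
open Summit.PneNP.PneNP.Theorems.PstarXorElimination (pdeg)
open Summit.PneNP.PneNP.Theorems.PstarCubeIdeals (IsAffineFn)
open Summit.PneNP.PneNP.Theorems.PstarQuadRank (rad)
open Summit.PneNP.PneNP.Theorems.PstarRankRigidityTwo (linPart symForm symForm_apply linPart_apply affine_mul_polar)
open Summit.PneNP.PneNP.Theorems.PstarForcing (polar_unique)
open Summit.PneNP.PneNP.Theorems.PstarProductRank (qform polar)
open Summit.PneNP.PneNP.Theorems.PstarPathRank (AndAdj polar_basis)
open Summit.PneNP.PneNP.Theorems.PstarChordSystem (ChordSystem)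
open Summit.PneNP.PneNP.Theorems.PstarChordBridgeTools (xpdeg)
open Summit.PneNP.PneNP.Theorems.PstarChordBridge (BridgeData sys sys_F sys_t)
open Summit.PneNP.PneNP.Theorems.PstarReadSumset (V2)
open Summit.PneNP.PneNP.Theorems.PstarChordBridgeForcing (freeMon freePolar gam rank_four_of_wf)
open Summit.PneNP.PneNP.Theorems.PstarChordBridgeBasis (qDir polarDir q_dir q_dir_add)
open Summit.PneNP.PneNP.Theorems.PstarNorUnitCases (mem_of_andAdj)
open Summit.PneNP.PneNP.Theorems.PstarNorUnitNA (nor_unit_na)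
open Summit.PneNP.PneNP.Theorems.PstarNorUnitBridge (xor_not_mem_bdry_of_even lit_iff_shift)

namespace Summit.PneNP.PneNP.Theorems.PstarNorUnitDir

variable {n m : ℕ}

/-- **Realisers of `polarDir`.**  `polarDir(e_v, e_w) = 1` forces some output of the joins or private-free pendants of the two constraints
to have AND pair `{v, w}`. -/
theorem exists_realiser_of_polarDir (I : LocalMap 4 n m) (hI : I.IsPure xorAndPred) (hS : SimpleOverlap I) (B : BridgeData n m) (mv : V2)
    {v w : Fin n} (h : polarDir I B mv (Pi.single v 1) (Pi.single w 1) = 1) :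
    ∃ g ∈ B.T₁ ∪ freeMon I B.N B.G₁ ∪ (B.T₂ ∪ freeMon I B.N B.G₂), v ∈ andPair I g ∧ w ∈ andPair I g := by
  classical
  unfold PstarChordBridgeBasis.polarDir PstarChordBridgeForcing.freePolar at h
  rw [LinearMap.add_apply, LinearMap.add_apply, LinearMap.smul_apply, LinearMap.smul_apply, LinearMap.smul_apply, LinearMap.smul_apply,
    LinearMap.add_apply, LinearMap.add_apply, LinearMap.add_apply, LinearMap.add_apply,
    polar_basis I hI hS, polar_basis I hI hS, polar_basis I hI hS, polar_basis I hI hS] at h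
  have key : (AndAdj I B.T₁ v w ∨ AndAdj I (freeMon I B.N B.G₁) v w) ∨ (AndAdj I B.T₂ v w ∨ AndAdj I (freeMon I B.N B.G₂) v w) := by
    by_contra hno
    obtain ⟨h₁, h₂⟩ := not_or.1 hno
    obtain ⟨h₁₁, h₁₂⟩ := not_or.1 h₁
    obtain ⟨h₂₁, h₂₂⟩ := not_or.1 h₂
    rw [if_neg h₁₁, if_neg h₁₂, if_neg h₂₁, if_neg h₂₂] at h
    simp at h
  rcases key with (h' | h') | (h' | h')
  · obtain ⟨g, hg, hm⟩ := mem_of_andAdj h'; exact ⟨g, mem_union_left _ (mem_union_left _ hg), hm⟩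
  · obtain ⟨g, hg, hm⟩ := mem_of_andAdj h'; exact ⟨g, mem_union_left _ (mem_union_right _ hg), hm⟩
  · obtain ⟨g, hg, hm⟩ := mem_of_andAdj h'; exact ⟨g, mem_union_right _ (mem_union_left _ hg), hm⟩
  · obtain ⟨g, hg, hm⟩ := mem_of_andAdj h'; exact ⟨g, mem_union_right _ (mem_union_right _ hg), hm⟩

/-- **The NOR case in direction `m` is a CONS-T unit.**  Hypotheses beyond the bridge data: `#(J₀ ∪ G₁ ∪ G₂) ≤ r`, `e ∉ G₁ ∪ G₂`, and the NOR
disjunct of `forced_chord_cases_dir` / `regime_cases` for the chord `e` verbatim (constants `β, α` arbitrary). -/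
theorem nor_unit_of_dir (I : LocalMap 4 n m) (hI : I.IsPure xorAndPred) (hS : SimpleOverlap I) {r : ℕ} (hB : BoundaryExpanding r I)
    {B : BridgeData n m} (hW : B.WF I) (hr : (B.J₀ ∪ B.G₁ ∪ B.G₂).card ≤ r) {e : Fin m} (he : e ∈ B.N) (heG : e ∉ B.G₁ ∪ B.G₂) (mv : V2)
    {a b : Fin n → ZMod 2} {β α : ZMod 2}
    (hq : ∀ x, qDir I B mv x = (polarDir I B mv x b + β) * (polarDir I B mv x a + α) + 1)
    {m₁ m₂ : (Fin n → ZMod 2) → ZMod 2} (hm₁ : IsAffineFn m₁) (hm₂ : IsAffineFn m₂)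
    (hQ : ∀ x, qform (B.D e) (fun j => I.vars j 2) (fun j => I.vars j 3) x + (gam B e + 1) =
      (polarDir I B mv x b + β + 1) * m₁ x + (polarDir I B mv x a + α + 1) * m₂ x) :
    ∃ j₁ j₂ : Fin m, ∃ σ τ : Fin n, j₁ ≠ j₂ ∧ B.D e = {j₁, j₂} ∧ Disjoint (andPair I j₁) (andPair I j₂) ∧ σ ∈ andPair I j₁ ∧ τ ∈ andPair I j₂ ∧
      (∀ v : Fin n, (polarDir I B mv (Pi.single v 1) b ≠ 0 ∨ polarDir I B mv (Pi.single v 1) a ≠ 0) ↔ (v = σ ∨ v = τ)) ∧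
      ∃ g ∈ B.T₁ ∪ freeMon I B.N B.G₁ ∪ (B.T₂ ∪ freeMon I B.N B.G₂), σ ∈ andPair I g ∧ τ ∈ andPair I g := by
  classical
  set fP := polarDir I B mv with hfP
  -- the two affine literal factors `μ₁ = λ_b + 1`, `μ₂ = λ_a + 1`, and the factors `λ_b, λ_a` of `q`
  have haff : ∀ (y : Fin n → ZMod 2) (k : ZMod 2), IsAffineFn (fun x => fP x y + k) := by
    intro y k x w
    show fP (x + w) y + k = fP x y + k + (fP w y + k) + (fP 0 y + k)
    rw [map_add, LinearMap.add_apply, map_zero, LinearMap.zero_apply, zero_add]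
    generalize fP x y = s; generalize fP w y = t
    revert s t k; decide
  have hμ₁ : IsAffineFn (fun x => fP x b + (β + 1)) := haff b (β + 1)
  have hμ₂ : IsAffineFn (fun x => fP x a + (α + 1)) := haff a (α + 1)
  have hlb : IsAffineFn (fun x => fP x b + β) := haff b β
  have hla : IsAffineFn (fun x => fP x a + α) := haff a α
  -- their linear parts are `fP · b`, `fP · a`
  have e3 : ∀ s k : ZMod 2, s + k + k = s := by decide
  have lin : ∀ {y : Fin n → ZMod 2} {k : ZMod 2} (h : IsAffineFn (fun x => fP x y + k)) (x : Fin n → ZMod 2), linPart h x = fP x y := by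
    intro y k h x
    rw [linPart_apply]
    show fP x y + k + (fP 0 y + k) = fP x y
    rw [map_zero, LinearMap.zero_apply, zero_add]
    exact e3 _ _
  have hQ' : ∀ x, qform (B.D e) (fun j => I.vars j 2) (fun j => I.vars j 3) x + (gam B e + 1) =
      (fun x => fP x b + (β + 1)) x * m₁ x + (fun x => fP x a + (α + 1)) x * m₂ x := by
    intro x; rw [hQ x]; simp only [add_assoc]
  -- `freePolar = sym(ℓ_b ⊗ ℓ_a)`: both are polar forms of `q`
  have hqB : ∀ x w, qDir I B mv (x + w) = qDir I B mv x + qDir I B mv w + qDir I B mv 0 + fP x w := by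
    intro x w
    have h := q_dir_add I B mv x w
    simp only [q_dir] at h
    exact h
  have hpol : fP = symForm (linPart hlb) (linPart hla) := by
    refine polar_unique (Q := qDir I B mv) hqB fun x w => ?_
    rw [hq, hq x, hq w, hq 0, affine_mul_polar hlb hla]
    generalize (fP x b + β) * (fP x a + α) = s; generalize (fP w b + β) * (fP w a + α) = s'
    generalize (fP 0 b + β) * (fP 0 a + α) = s₀; generalize symForm (linPart hlb) (linPart hla) x w = t
    revert s s' s₀ t; decide
  -- the gadget set: realisers of the literal products outside `D e + e`
  set G : Finset (Fin m) := (B.T₁ ∪ freeMon I B.N B.G₁ ∪ (B.T₂ ∪ freeMon I B.N B.G₂)).filter fun g => g ∉ insert e (B.D e) with hGdef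
  have heD : e ∉ B.D e := fun h => (mem_sdiff.1 (hW.hD e he h)).2 he
  have hGd : Disjoint G (insert e (B.D e)) := by
    rw [Finset.disjoint_left]
    intro g hg
    exact (mem_filter.1 hg).2
  have hsub : insert e (B.D e) ∪ G ⊆ B.J₀ ∪ B.G₁ ∪ B.G₂ := by
    intro g hg
    rcases mem_union.1 hg with hg | hg
    · rcases mem_insert.1 hg with rfl | hg
      · exact mem_union_left _ (mem_union_left _ (hW.hN he))
      · exact mem_union_left _ (mem_union_left _ (mem_sdiff.1 (hW.hD e he hg)).1)
    · have hg' := (mem_filter.1 hg).1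
      rcases mem_union.1 hg' with hg' | hg' <;> rcases mem_union.1 hg' with hg' | hg'
      · exact mem_union_left _ (mem_union_left _ (mem_sdiff.1 (hW.hT₁ hg')).1)
      · exact mem_union_left _ (mem_union_right _ (mem_filter.1 hg').1)
      · exact mem_union_left _ (mem_union_left _ (mem_sdiff.1 (hW.hT₂ hg')).1)
      · exact mem_union_right _ (mem_filter.1 hg').1
  have hr' : (insert e (B.D e) ∪ G).card ≤ r := (card_le_card hsub).trans hr
  have hcyc := xor_not_mem_bdry_of_even I hI (hW.hDeven e he)
  have hrank := rank_four_of_wf I hI hS hB hW ((card_le_card (subset_union_left.trans subset_union_left)).trans hr) he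
  -- the gadget hypothesis for pairs not AND-adjacent in `D e`
  have hK : ∀ v w : Fin n, v ≠ w → ¬ AndAdj I (B.D e) v w →
      linPart hμ₁ (Pi.single v 1) * linPart hμ₂ (Pi.single w 1) + linPart hμ₁ (Pi.single w 1) * linPart hμ₂ (Pi.single v 1) = 1 →
        ∃ g ∈ G, v ∈ andPair I g ∧ w ∈ andPair I g := by
    intro v w hvw hna hdet
    rw [lin hμ₁, lin hμ₁, lin hμ₂, lin hμ₂] at hdet
    -- this is `freePolar (e_v) (e_w)`
    have hval : fP (Pi.single v 1) (Pi.single w 1) = 1 := by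
      rw [hpol, symForm_apply, lin hlb, lin hlb, lin hla, lin hla]
      exact hdet
    rw [hfP] at hval
    obtain ⟨g, hg, hvg, hwg⟩ := exists_realiser_of_polarDir I hI hS B mv hval
    refine ⟨g, mem_filter.2 ⟨hg, fun hge => ?_⟩, hvg, hwg⟩
    rcases mem_insert.1 hge with rfl | hgD
    · -- `e` is neither a join output nor a pendant
      rcases mem_union.1 hg with h | h <;> rcases mem_union.1 h with h | h
      · exact (mem_sdiff.1 (hW.hT₁ h)).2 he
      · exact heG (mem_union_left _ (mem_filter.1 h).1)
      · exact (mem_sdiff.1 (hW.hT₂ h)).2 he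
      · exact heG (mem_union_right _ (mem_filter.1 h).1)
    · -- a realiser inside `D e` would make `v, w` AND-adjacent there
      refine hna ?_
      rw [mem_andPair_iff] at hvg hwg
      rcases hvg with rfl | rfl <;> rcases hwg with rfl | rfl
      · exact absurd rfl hvw
      · exact ⟨g, hgD, Or.inl ⟨rfl, rfl⟩⟩
      · exact ⟨g, hgD, Or.inr ⟨rfl, rfl⟩⟩
      · exact absurd rfl hvw
  obtain ⟨j₁, j₂, σ, τ, hne, hDe, hdisj, hσ, hτ, hlit, g, hg, hσg, hτg⟩ :=
    nor_unit_na hI hS hB heD hGd hr' hcyc hμ₁ hμ₂ hm₁ hm₂ hQ' hK hrank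
  refine ⟨j₁, j₂, σ, τ, hne, hDe, hdisj, hσ, hτ, fun v => ?_, g, (mem_filter.1 hg).1, hσg, hτg⟩
  rw [← hlit v, lin hμ₁, lin hμ₂]

/-! ## The literal pair depends only on `q` -/

open Summit.PneNP.PneNP.Theorems.PstarPathRank (polar_self_and polar_symm_and)

/-- **The literal pair of `nor_unit_of_dir` is chord-independent**: `v` is a literal iff `q_m` is not invariant under `x ↦ x + e_v`. -/
theorem lit_iff_of_dir (I : LocalMap 4 n m) (B : BridgeData n m) (mv : V2) {a b : Fin n → ZMod 2} {β α : ZMod 2}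
    (hab : polarDir I B mv a b = 1)
    (hq : ∀ x, qDir I B mv x = (polarDir I B mv x b + β) * (polarDir I B mv x a + α) + 1) (v : Fin n) :
    (polarDir I B mv (Pi.single v 1) b ≠ 0 ∨ polarDir I B mv (Pi.single v 1) a ≠ 0) ↔
      ∃ x, qDir I B mv (x + Pi.single v 1) ≠ qDir I B mv x := by
  have hsymm : ∀ x y : Fin n → ZMod 2, polarDir I B mv x y = polarDir I B mv y x := by
    intro x y
    unfold PstarChordBridgeBasis.polarDir PstarChordBridgeForcing.freePolar
    simp only [LinearMap.add_apply, LinearMap.smul_apply]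
    rw [polar_symm_and I B.T₁ x y, polar_symm_and I (freeMon I B.N B.G₁) x y, polar_symm_and I B.T₂ x y,
      polar_symm_and I (freeMon I B.N B.G₂) x y]
  have hself : ∀ x : Fin n → ZMod 2, polarDir I B mv x x = 0 := by
    intro x
    unfold PstarChordBridgeBasis.polarDir PstarChordBridgeForcing.freePolar
    simp only [LinearMap.add_apply, LinearMap.smul_apply, polar_self_and, smul_zero, add_zero]
  exact lit_iff_shift (polarDir I B mv) (q := qDir I B mv) hq hab (by rw [hsymm]; exact hab) (hself a) (hself b) (Pi.single v 1)

end Summit.PneNP.PneNP.Theorems.PstarNorUnitDir
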